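import Summits.QuantumFields.BalabanUV.Beta.GAN24.BiStencilZeroMode
import Summits.QuantumFields.BalabanUV.Beta.GAN24.HarmonicPeriodicTwoForm
import Summits.QuantumFields.BalabanUV.Beta.GAN24.ZeroModeParity
import Literature.MathematicalPhysics.QuantumFieldTheory.Balaban1983to89.Beta.ResolventReflection
import Summits.QuantumFields.BalabanUV.Beta.DiagonalContact

/-!
# `BalabanUV.Beta.GAN24.ZeroModeReflectionParity` — binder row G-an2-4 ∕ (CONV-C), W-slot, row (C) at levels ≥ 1: **THE ZERO-MODE CHARGE OF AN
# AXIS-REFLECTION-COVARIANT BI-STENCIL FAMILY CARRIES THE PRODUCT OF ITS FOUR REFLECTION SIGNS — SO IT VANISHES ON EVERY PATTERN IN WHICH SOME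
# DIRECTION OCCURS AN ODD NUMBER OF TIMES; WITH A COVARIANCE DEFECT `J` THE CHARGE OF `T` IS THE SIGNED CHARGE OF `T + J`**
# (road-P2 chair of row G-an2-4, unit `b2b-balaban-gan24-p2` gen 47, crux team (2); READING R-1 [GAN24P2-G47-R1]: in leaf-06 g51's kit j192575 (D = 2, levels 0→1, 1→2)
# the one-step symmetrised ff charge of the dressed AND of the undressed comb step is zero to rounding on all eight odd-multiplicity patterns, word by word)

NOT IN PRINT; OUR BOOKKEEPING ([folklore] re-indexing of one finite box sum and three lattice sums; 0 `def`, 0 cited facts, 0 `def … : Prop`, 0 sorry;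
NO summability hypothesis anywhere — every re-indexing is by a bijection).  HONEST FRAMING (cell contract, verbatim): «discharging `BetaPertH` makes
Bałaban's UV stability UNCONDITIONAL — a real constructive-QFT result; it is NOT the continuum limit and NOT the Clay problem.»  HONEST DEPENDENCY
(verbatim): «continuum YM on T⁴ ⇐ BetaPertH ∧ nine spine estimates (0/9 proved); BetaPertH ⇐ (D1) ∧ (D4) ∧ CAP+tail; G-an2-4 gates asym, D1 and NE2/3/4.»

WHAT (generic `d`, any period `N ≥ 1`, any axis `α`; `zmode` = `BiStencilZeroMode.zmode`, the reflection vocabulary = an5 ∕ an2's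
`ResolventReflection` (`bref α κ` the bond base-point map, `Φ N α` the leg map, `reflSign`) and `KernelReflection.refK`):
* §1 `inner_refl_add` — THE POINTWISE STEP: if `T κ (bref α κ u) κ′ (bref α κ′ u′) = (ε_κ ε_κ′) • refK (Φ N α) (T κ u κ′ u′ + J κ u κ′ u′)` for all bonds
  (`ε = reflSign α`; `J` = ANY covariance defect — for the comb tower of record `J` is the displayed gauge contact + odd remainder of an2's
  `SpineRecursiveT2All.T2RecAt_bref_all_of_letters`; `J = 0` for a plainly covariant family), then for every first bond position `u`
  `Σ'_{u′} Σ'_x Σ'_z T κ (bref α κ u) κ′ u′ x z (inl κ₁) (inl κ₂) = (ε_κ ε_κ′ ε_κ₁ ε_κ₂) · Σ'_{u′} Σ'_x Σ'_z (T + J) κ u κ′ u′ x z (inl κ₁) (inl κ₂)`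
  (re-index `u′`, `x`, `z` by the involutions `bref α κ′`, `bref α κ₁`, `bref α κ₂`).
* §2 **`zmode_refl_add`** — THE CHARGE IDENTITY: if moreover `T` is jointly `N`-block covariant (`hT`, the hypothesis shape of `zmode_add` ∕ `inner_periodic`),
  `zmode N T κ κ′ (inl κ₁) (inl κ₂) = (ε_κ ε_κ′ ε_κ₁ ε_κ₂) · zmode N (T + J) κ κ′ (inl κ₁) (inl κ₂)` (the first bond position: `bref α κ (toSite r) = toSite (bflip α N r) + c`
  with the CONSTANT `c = −N•e_α − [κ = α]•e_α`; `sum_box_bflip` + `HarmonicPeriodicTwoForm.sum_box_shift` on the `N`-periodic inner sum `inner_periodic`);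
  **`zmode_refl`** (`J = 0`): `zmode N T … = (ε_κ ε_κ′ ε_κ₁ ε_κ₂) · zmode N T …`; **`zmode_eq_zero_of_reflSign_prod`**: `= 0` whenever the sign product is `−1`,
  i.e. whenever `α` occurs an ODD number of times among `(κ, κ′, κ₁, κ₂)`; **`two_mul_zmode_eq_neg_of_reflSign_prod`** (with a defect): on such a pattern
  `2 · zmode N T = −(zmode N (T + J) − zmode N T)` — the charge of `T` is minus half the charge the defect adds.
* §3 **`zmode_inl_inl_add_legSwap_eq_zero_of_parityOdd`** — THE REMAINDER HALF OF THE DEFECT: a row-parity-odd `LocStencil₂` table (`trK (R κ u κ′ u′) =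
  −sgnK (R κ u κ′ u′)`, the class of an2's `R2` and of MY g44 `WardResidualParity` residual tower) has LEG-ANTISYMMETRIC ff charge: `zmode N R κ κ′ (inl κ₁) (inl κ₂) +
  zmode N R κ κ′ (inl κ₂) (inl κ₁) = 0` (the OWNER's `ZeroModeParity.zmode_sgnK_trK_inl_inl`; leaf-02 g64's `ResidualChargeLegAntisymm` is the sandwiched instance) — so a
  parity-odd defect adds NO leg-symmetrised charge.
* §4 THE CUBIC TWIN: `cubicCharge_refl_add` (the one-bond-slot cell charge `Σ_{r∈box} Σ'_x Σ'_z S κ′ (toSite r) x z (inl κ₁) (inl κ₂)` carries `ε_κ′ ε_κ₁ ε_κ₂` modulo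
  the defect, law shape = an2's (Sr-conj) `SrecAt_succ_bref_of_e3Law`), `exists_reflSign_prod₃_eq_neg_one` (a THREE-index pattern ALWAYS has an odd axis), hence
  **`cubicCharge_eq_zero_of_refl`** (a vertex family plainly reflection-covariant in every axis has ZERO cell charge on its whole ff block) and
  `two_mul_cubicCharge_eq_neg_of_reflSign_prod` (with a defect: the cubic charge is minus half the charge the (Sr-conj) contact adds) — R-2 (2)(b)'s generic half.
* §5 **`tsum_tsum_add_conjV_diagK_eq`** — THE DELTA-LEG CONTACT ADDS NO ff CHARGE: if the generator's FIELD leg is a single-site single-component delta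
  (`g x (inl β) = [x = u₀ ∧ β = β₀]·c₀`, the shape of an2's `DiagonalContact.ctGen`'s field leg) and the sandwich kernel `𝕄` has summable rows∕columns with ZERO
  constant modes on the ff block (`Σ'_z 𝕄 y z (inl a)(inl b) = 0 = Σ'_x 𝕄 x y (inl a)(inl b)` — the `E2·const = 0` Ward zeros), then
  `Σ'_x Σ'_z (S + conjV 𝕄 (diagK g)) x z (inl κ₁)(inl κ₂) = Σ'_x Σ'_z S x z (inl κ₁)(inl κ₂)`; hence **`cubicCharge_eq_zero_of_refl_conjV`**: a covariant vertex family
  obeying the (Sr-conj)-shaped law in every axis with such contacts has ZERO ff cell charge — the cubic three-index charges of R-2 (2)(b) vanish outright.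
READING (zero weight): for the literal's (C) binder (MY `WrecAtEvenHalfRowsOfQLCSymLeg` §2's `hC₂`, d = 3, 256 patterns) this is the located route by which
the 216 patterns outside the two-pair class {a,a,b,b} and the all-equal class need NO exchange ∕ contact letter: they are dead by parity once the comb
tower's defect `J` (gauge contact + parity-odd remainder) is shown charge-free leg-symmetrised — an2's ∕ leaf-02's lane (ASKS A-g47-1∕2∕3).  Discharges NOTHING
of (C)_{≥1} by itself; NEVER «G-an2-4 closed» as (CONV-C); NOT D1, NOT `BetaPertH`, NOT continuum, NOT Clay.  2026-08-23; no existing file touched.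
-/

noncomputable section

open Finset
open scoped BigOperators
open Literature.MathematicalPhysics.QuantumFieldTheory
open Literature.MathematicalPhysics.QuantumFieldTheory.Balaban1983to89
open Literature.MathematicalPhysics.QuantumFieldTheory.Balaban1983to89.Beta
open ExpKernelCalculus (MKer shiftK)
open OneStepResolventKernel (Fib)
open AffineAveraging (box toSite unitVec unitVec_apply)
open PolarizationSign (reflSign)
open KernelReflection (refK)
open ResolventReflection (bref bref_apply bref_bref bflip sum_box_bflip toSite_bflip Φ Φ_r_inl Φ_s_inl reflSign_mul_self)
open PeriodicDescent (IsPeriodic)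
open Summit.QuantumFields.BalabanUV.Beta.GAN24.BiStencilZeroMode (Tab zmode inner_periodic)
open Summit.QuantumFields.BalabanUV.Beta.GAN24.HarmonicPeriodicTwoForm (sum_box_shift)
open BalabanCompositeJets (LocStencil₂)
open Summit.QuantumFields.BalabanUV.Beta.TameKernelCalculus (trK)
open Summit.QuantumFields.BalabanUV.Beta.BorderedHessian (sgnK sgnK_sgnK)
open Summit.QuantumFields.BalabanUV.Beta.BubbleParity (sgnK_neg)
open Summit.QuantumFields.BalabanUV.Beta.GAN24.WSlotFirstDiff (zmode_smul)
open Summit.QuantumFields.BalabanUV.Beta.GAN24.ZeroModeParity (zmode_sgnK_trK_inl_inl)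
open Summit.QuantumFields.BalabanUV.Beta.ChartConjugation (conjV)
open Summit.QuantumFields.BalabanUV.Beta.BorderedHessian (diagK conjV_diagK_apply)
open Summit.QuantumFields.BalabanUV.Beta.AxialDressingRooted (tsum_point tsum_point')

namespace Summit.QuantumFields.BalabanUV.Beta.GAN24.ZeroModeReflectionParity

variable {d : ℕ}

/-! ## §1 The pointwise step: reflecting the first bond position -/
/-- [folklore] Re-indexing a lattice sum by the bond base-point involution `bref α β`. -/
theorem tsum_comp_bref (α β : Fin (d + 1)) (G : (Fin (d + 1) → ℤ) → ℝ) : ∑' v, G (bref α β v) = ∑' v, G v :=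
  (Function.Involutive.toPerm (bref α β) (bref_bref α β)).tsum_eq G

/-- NOT IN PRINT; OUR BOOKKEEPING.  **THE POINTWISE STEP**: under the reflection law with defect `J`, the inner triple sum at the reflected first
bond position is the signed inner triple sum of `T + J` (re-index `u′`, `x`, `z` by the three involutions; no summability needed). -/
theorem inner_refl_add {N : ℕ} {T J : Tab d} (α : Fin (d + 1))
    (hR : ∀ (κ : Fin (d + 1)) (u : Fin (d + 1) → ℤ) (κ' : Fin (d + 1)) (u' : Fin (d + 1) → ℤ),
      T κ (bref α κ u) κ' (bref α κ' u') = (reflSign α κ * reflSign α κ') • refK (Φ N α) (T κ u κ' u' + J κ u κ' u'))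
    (κ κ' κ₁ κ₂ : Fin (d + 1)) (u : Fin (d + 1) → ℤ) :
    (∑' u', ∑' x, ∑' z, T κ (bref α κ u) κ' u' x z (Sum.inl κ₁) (Sum.inl κ₂))
      = (reflSign α κ * reflSign α κ' * reflSign α κ₁ * reflSign α κ₂) *
          ∑' u', ∑' x, ∑' z, (T κ u κ' u' x z (Sum.inl κ₁) (Sum.inl κ₂) + J κ u κ' u' x z (Sum.inl κ₁) (Sum.inl κ₂)) := by
  rw [← tsum_comp_bref α κ' (fun u' => ∑' x, ∑' z, T κ (bref α κ u) κ' u' x z (Sum.inl κ₁) (Sum.inl κ₂)), ← tsum_mul_left]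
  refine tsum_congr fun u' => ?_
  rw [← tsum_comp_bref α κ₁ (fun x => ∑' z, T κ (bref α κ u) κ' (bref α κ' u') x z (Sum.inl κ₁) (Sum.inl κ₂)), ← tsum_mul_left]
  refine tsum_congr fun x => ?_
  rw [← tsum_comp_bref α κ₂ (fun z => T κ (bref α κ u) κ' (bref α κ' u') (bref α κ₁ x) z (Sum.inl κ₁) (Sum.inl κ₂)), ← tsum_mul_left]
  refine tsum_congr fun z => ?_
  rw [hR κ u κ' u']
  simp only [Pi.smul_apply, smul_eq_mul, refK, Φ_r_inl, Φ_s_inl, bref_bref, Pi.add_apply]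
  ring

/-! ## §2 The charge identity and the parity zeros -/

/-- [folklore] The reflected first bond position of a box offset: `bref α κ (toSite r) = toSite (bflip α N r) + c` with the CONSTANT shift
`c = −N•e_α − [κ = α]•e_α`. -/
theorem bref_toSite_eq {N : ℕ} (α κ : Fin (d + 1)) {r : Fin (d + 1) → ℕ} (hr : r ∈ box (d + 1) N) :
    bref α κ (toSite r) = toSite (bflip α N r) + (-((N : ℤ) • unitVec α) - (if κ = α then unitVec α else 0)) := by
  funext i
  rw [bref_apply, Pi.add_apply, Pi.sub_apply, Pi.neg_apply, Pi.smul_apply, toSite_bflip α hr, smul_eq_mul, unitVec_apply]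
  by_cases hi : i = α
  · subst hi
    simp only [if_true, ResolventReflection.toSite_apply]
    by_cases hκ : κ = i
    · simp only [hκ, if_true, unitVec_apply]; ring
    · simp only [hκ, if_false, Pi.zero_apply]; ring
  · simp only [hi, if_false, ResolventReflection.toSite_apply, mul_zero, neg_zero, zero_sub]
    by_cases hκ : κ = α
    · simp only [hκ, if_true, unitVec_apply, hi, if_false, neg_zero, add_zero]
    · simp only [hκ, if_false, Pi.zero_apply, neg_zero, add_zero]

/-- NOT IN PRINT; OUR BOOKKEEPING.  **THE CHARGE IDENTITY WITH A COVARIANCE DEFECT**: for a jointly `N`-block-covariant bi-stencil family `T` obeying the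
axis-`α` reflection law with defect `J`, `zmode N T κ κ′ (inl κ₁) (inl κ₂) = (ε_κ ε_κ′ ε_κ₁ ε_κ₂) · zmode N (T + J) κ κ′ (inl κ₁) (inl κ₂)`. -/
theorem zmode_refl_add {N : ℕ} [NeZero N] {T J : Tab d} (α : Fin (d + 1))
    (hT : ∀ (κ : Fin (d + 1)) (u : Fin (d + 1) → ℤ) (κ' : Fin (d + 1)) (u' t : Fin (d + 1) → ℤ),
      T κ (u + (N : ℤ) • t) κ' (u' + (N : ℤ) • t) = shiftK (-((N : ℤ) • t)) (T κ u κ' u'))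
    (hR : ∀ (κ : Fin (d + 1)) (u : Fin (d + 1) → ℤ) (κ' : Fin (d + 1)) (u' : Fin (d + 1) → ℤ),
      T κ (bref α κ u) κ' (bref α κ' u') = (reflSign α κ * reflSign α κ') • refK (Φ N α) (T κ u κ' u' + J κ u κ' u'))
    (κ κ' κ₁ κ₂ : Fin (d + 1)) :
    zmode N T κ κ' (Sum.inl κ₁) (Sum.inl κ₂)
      = (reflSign α κ * reflSign α κ' * reflSign α κ₁ * reflSign α κ₂) *
          zmode N (fun κ u κ' u' => T κ u κ' u' + J κ u κ' u') κ κ' (Sum.inl κ₁) (Sum.inl κ₂) := by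
  set c : Fin (d + 1) → ℤ := -((N : ℤ) • unitVec α) - (if κ = α then unitVec α else 0) with hc
  have hper : IsPeriodic N (fun u => ∑' u', ∑' x, ∑' z, T κ u κ' u' x z (Sum.inl κ₁) (Sum.inl κ₂)) :=
    fun u t => inner_periodic hT κ κ' (Sum.inl κ₁) (Sum.inl κ₂) u t
  unfold zmode
  calc ∑ r ∈ box (d + 1) N, ∑' u', ∑' x, ∑' z, T κ (toSite r) κ' u' x z (Sum.inl κ₁) (Sum.inl κ₂)
      = ∑ r ∈ box (d + 1) N, ∑' u', ∑' x, ∑' z, T κ (toSite r + c) κ' u' x z (Sum.inl κ₁) (Sum.inl κ₂) := (sum_box_shift hper c).symm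
    _ = ∑ r ∈ box (d + 1) N, ∑' u', ∑' x, ∑' z, T κ (toSite (bflip α N r) + c) κ' u' x z (Sum.inl κ₁) (Sum.inl κ₂) :=
        (sum_box_bflip α N (fun r => ∑' u', ∑' x, ∑' z, T κ (toSite r + c) κ' u' x z (Sum.inl κ₁) (Sum.inl κ₂))).symm
    _ = ∑ r ∈ box (d + 1) N, ∑' u', ∑' x, ∑' z, T κ (bref α κ (toSite r)) κ' u' x z (Sum.inl κ₁) (Sum.inl κ₂) :=
        Finset.sum_congr rfl fun r hr => by rw [bref_toSite_eq α κ hr]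
    _ = ∑ r ∈ box (d + 1) N, (reflSign α κ * reflSign α κ' * reflSign α κ₁ * reflSign α κ₂) *
          ∑' u', ∑' x, ∑' z, (T κ (toSite r) κ' u' x z (Sum.inl κ₁) (Sum.inl κ₂) + J κ (toSite r) κ' u' x z (Sum.inl κ₁) (Sum.inl κ₂)) :=
        Finset.sum_congr rfl fun r _ => inner_refl_add α hR κ κ' κ₁ κ₂ (toSite r)
    _ = (reflSign α κ * reflSign α κ' * reflSign α κ₁ * reflSign α κ₂) *
          ∑ r ∈ box (d + 1) N, ∑' u', ∑' x, ∑' z, (fun κ u κ' u' => T κ u κ' u' + J κ u κ' u') κ (toSite r) κ' u' x z (Sum.inl κ₁) (Sum.inl κ₂) := by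
        rw [Finset.mul_sum]
        rfl

/-- NOT IN PRINT; OUR BOOKKEEPING.  **THE CHARGE OF A PLAINLY REFLECTION-COVARIANT FAMILY CARRIES THE PRODUCT OF ITS FOUR SIGNS** (`J = 0`). -/
theorem zmode_refl {N : ℕ} [NeZero N] {T : Tab d} (α : Fin (d + 1))
    (hT : ∀ (κ : Fin (d + 1)) (u : Fin (d + 1) → ℤ) (κ' : Fin (d + 1)) (u' t : Fin (d + 1) → ℤ),
      T κ (u + (N : ℤ) • t) κ' (u' + (N : ℤ) • t) = shiftK (-((N : ℤ) • t)) (T κ u κ' u'))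
    (hR : ∀ (κ : Fin (d + 1)) (u : Fin (d + 1) → ℤ) (κ' : Fin (d + 1)) (u' : Fin (d + 1) → ℤ),
      T κ (bref α κ u) κ' (bref α κ' u') = (reflSign α κ * reflSign α κ') • refK (Φ N α) (T κ u κ' u'))
    (κ κ' κ₁ κ₂ : Fin (d + 1)) :
    zmode N T κ κ' (Sum.inl κ₁) (Sum.inl κ₂)
      = (reflSign α κ * reflSign α κ' * reflSign α κ₁ * reflSign α κ₂) * zmode N T κ κ' (Sum.inl κ₁) (Sum.inl κ₂) := by
  have h := zmode_refl_add (J := fun _ _ _ _ => 0) α hT (fun κ u κ' u' => by rw [hR]; simp only [add_zero]) κ κ' κ₁ κ₂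
  simpa only [add_zero] using h

/-- NOT IN PRINT; OUR BOOKKEEPING.  **PARITY ZERO**: a plainly reflection-covariant, jointly covariant family has ZERO charge on every pattern whose
four reflection signs multiply to `−1` — i.e. on every pattern in which the axis `α` occurs an ODD number of times among `(κ, κ′, κ₁, κ₂)`. -/
theorem zmode_eq_zero_of_reflSign_prod {N : ℕ} [NeZero N] {T : Tab d} (α : Fin (d + 1))
    (hT : ∀ (κ : Fin (d + 1)) (u : Fin (d + 1) → ℤ) (κ' : Fin (d + 1)) (u' t : Fin (d + 1) → ℤ),
      T κ (u + (N : ℤ) • t) κ' (u' + (N : ℤ) • t) = shiftK (-((N : ℤ) • t)) (T κ u κ' u'))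
    (hR : ∀ (κ : Fin (d + 1)) (u : Fin (d + 1) → ℤ) (κ' : Fin (d + 1)) (u' : Fin (d + 1) → ℤ),
      T κ (bref α κ u) κ' (bref α κ' u') = (reflSign α κ * reflSign α κ') • refK (Φ N α) (T κ u κ' u'))
    {κ κ' κ₁ κ₂ : Fin (d + 1)} (hodd : reflSign α κ * reflSign α κ' * reflSign α κ₁ * reflSign α κ₂ = -1) :
    zmode N T κ κ' (Sum.inl κ₁) (Sum.inl κ₂) = 0 := by
  have h := zmode_refl α hT hR κ κ' κ₁ κ₂
  rw [hodd] at h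
  linarith

/-- NOT IN PRINT; OUR BOOKKEEPING.  **WITH A DEFECT**: on a pattern whose four signs multiply to `−1`, twice the charge of `T` is minus the charge the
defect adds: `2 · zmode N T = −(zmode N (T + J) − zmode N T)` — so `T`'s charge vanishes there iff `J` adds no charge. -/
theorem two_mul_zmode_eq_neg_of_reflSign_prod {N : ℕ} [NeZero N] {T J : Tab d} (α : Fin (d + 1))
    (hT : ∀ (κ : Fin (d + 1)) (u : Fin (d + 1) → ℤ) (κ' : Fin (d + 1)) (u' t : Fin (d + 1) → ℤ),
      T κ (u + (N : ℤ) • t) κ' (u' + (N : ℤ) • t) = shiftK (-((N : ℤ) • t)) (T κ u κ' u'))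
    (hR : ∀ (κ : Fin (d + 1)) (u : Fin (d + 1) → ℤ) (κ' : Fin (d + 1)) (u' : Fin (d + 1) → ℤ),
      T κ (bref α κ u) κ' (bref α κ' u') = (reflSign α κ * reflSign α κ') • refK (Φ N α) (T κ u κ' u' + J κ u κ' u'))
    {κ κ' κ₁ κ₂ : Fin (d + 1)} (hodd : reflSign α κ * reflSign α κ' * reflSign α κ₁ * reflSign α κ₂ = -1) :
    2 * zmode N T κ κ' (Sum.inl κ₁) (Sum.inl κ₂)
      = -(zmode N (fun κ u κ' u' => T κ u κ' u' + J κ u κ' u') κ κ' (Sum.inl κ₁) (Sum.inl κ₂) - zmode N T κ κ' (Sum.inl κ₁) (Sum.inl κ₂)) := by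
  have h := zmode_refl_add α hT hR κ κ' κ₁ κ₂
  rw [hodd] at h
  linarith

/-- NOT IN PRINT; OUR BOOKKEEPING.  **THE SIGN PRODUCT, COUNTED**: `ε_κ ε_κ′ ε_κ₁ ε_κ₂ = −1` iff `α` occurs an odd number of times among the four
indices (`reflSign α μ = −1 ↔ μ = α`). -/
theorem reflSign_prod_eq_neg_one_iff (α κ κ' κ₁ κ₂ : Fin (d + 1)) :
    reflSign α κ * reflSign α κ' * reflSign α κ₁ * reflSign α κ₂ = -1 ↔
      Odd ((if κ = α then 1 else 0) + (if κ' = α then 1 else 0) + (if κ₁ = α then 1 else 0) + (if κ₂ = α then 1 else 0) : ℕ) := by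
  simp only [PolarizationSign.reflSign]
  by_cases h1 : κ = α <;> by_cases h2 : κ' = α <;> by_cases h3 : κ₁ = α <;> by_cases h4 : κ₂ = α <;>
    simp [h1, h2, h3, h4] <;> norm_num


/-! ## §3 The remainder half of the defect: a parity-odd table adds no leg-symmetrised charge -/

/-- NOT IN PRINT; OUR BOOKKEEPING.  **A ROW-PARITY-ODD `LocStencil₂` TABLE HAS LEG-ANTISYMMETRIC ff CHARGE**: `zmode N R κ κ′ (inl κ₁) (inl κ₂) +
zmode N R κ κ′ (inl κ₂) (inl κ₁) = 0` (the parity image `sgnK ∘ trK` swaps the two leg fibres in the charge — the OWNER's `zmode_sgnK_trK_inl_inl` — and equals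
`−R` for a parity-odd table). -/
theorem zmode_inl_inl_add_legSwap_eq_zero_of_parityOdd {N : ℕ} {R : Tab d} {C δ : ℝ} (hR : LocStencil₂ R C δ) (hδ : 0 < δ)
    (hodd : ∀ (κ : Fin (d + 1)) (u : Fin (d + 1) → ℤ) (κ' : Fin (d + 1)) (u' : Fin (d + 1) → ℤ), trK (R κ u κ' u') = -sgnK (R κ u κ' u'))
    (κ κ' κ₁ κ₂ : Fin (d + 1)) :
    zmode N R κ κ' (Sum.inl κ₁) (Sum.inl κ₂) + zmode N R κ κ' (Sum.inl κ₂) (Sum.inl κ₁) = 0 := by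
  have hP : (fun κ u κ' u' => sgnK (trK (R κ u κ' u'))) = fun κ u κ' u' => (-1 : ℝ) • R κ u κ' u' := by
    funext κ u κ' u'
    rw [hodd, sgnK_neg, sgnK_sgnK, neg_one_smul]
  have h := zmode_sgnK_trK_inl_inl (N := N) hR hδ κ κ' κ₂ κ₁
  rw [hP, zmode_smul] at h
  linarith


/-! ## §4 The cubic twin: a three-index cell charge ALWAYS has an odd axis -/

/-- [folklore] Re-indexed inner double sum of a CUBIC (one-bond-slot) family under the reflection law with defect `J`:
`Σ'_x Σ'_z S κ′ (bref α κ′ u) x z (inl κ₁) (inl κ₂) = (ε_κ′ ε_κ₁ ε_κ₂) · Σ'_x Σ'_z (S + J) κ′ u x z (inl κ₁) (inl κ₂)` (the law's SHAPE is an2's (Sr-conj)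
`StepReflectionRec.SrecAt_succ_bref_of_e3Law`: `S κ′ (bref α κ′ u) = reflSign α κ′ • refK (Φ N α) (S κ′ u + J κ′ u)`, `J` = its `conjV` contact). -/
theorem inner_refl_add₃ {N : ℕ} {S J : Fin (d + 1) → (Fin (d + 1) → ℤ) → MKer (d + 1) (Fib d)} (α : Fin (d + 1))
    (hR : ∀ (κ' : Fin (d + 1)) (u : Fin (d + 1) → ℤ), S κ' (bref α κ' u) = reflSign α κ' • refK (Φ N α) (S κ' u + J κ' u))
    (κ' κ₁ κ₂ : Fin (d + 1)) (u : Fin (d + 1) → ℤ) :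
    (∑' x, ∑' z, S κ' (bref α κ' u) x z (Sum.inl κ₁) (Sum.inl κ₂))
      = (reflSign α κ' * reflSign α κ₁ * reflSign α κ₂) *
          ∑' x, ∑' z, (S κ' u x z (Sum.inl κ₁) (Sum.inl κ₂) + J κ' u x z (Sum.inl κ₁) (Sum.inl κ₂)) := by
  rw [← tsum_comp_bref α κ₁ (fun x => ∑' z, S κ' (bref α κ' u) x z (Sum.inl κ₁) (Sum.inl κ₂)), ← tsum_mul_left]
  refine tsum_congr fun x => ?_
  rw [← tsum_comp_bref α κ₂ (fun z => S κ' (bref α κ' u) (bref α κ₁ x) z (Sum.inl κ₁) (Sum.inl κ₂)), ← tsum_mul_left]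
  refine tsum_congr fun z => ?_
  rw [hR κ' u]
  simp only [Pi.smul_apply, smul_eq_mul, refK, Φ_r_inl, Φ_s_inl, bref_bref, Pi.add_apply]
  ring

/-- NOT IN PRINT; OUR BOOKKEEPING.  **THE CUBIC CELL CHARGE WITH A COVARIANCE DEFECT**: for an `N`-block-covariant vertex family `S κ′ u′` (`S κ′ (u′ + N•t) =
shiftK (−N•t) (S κ′ u′)`, the shape of an2's `…_translate` rows) obeying the axis-`α` reflection law with defect `J`,
`Σ_{r∈box} Σ'_x Σ'_z S κ′ (toSite r) x z (inl κ₁) (inl κ₂) = (ε_κ′ ε_κ₁ ε_κ₂) · Σ_{r∈box} Σ'_x Σ'_z (S + J) κ′ (toSite r) x z (inl κ₁) (inl κ₂)`. -/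
theorem cubicCharge_refl_add {N : ℕ} [NeZero N] {S J : Fin (d + 1) → (Fin (d + 1) → ℤ) → MKer (d + 1) (Fib d)} (α : Fin (d + 1))
    (hS : ∀ (κ' : Fin (d + 1)) (u' t : Fin (d + 1) → ℤ), S κ' (u' + (N : ℤ) • t) = shiftK (-((N : ℤ) • t)) (S κ' u'))
    (hR : ∀ (κ' : Fin (d + 1)) (u : Fin (d + 1) → ℤ), S κ' (bref α κ' u) = reflSign α κ' • refK (Φ N α) (S κ' u + J κ' u))
    (κ' κ₁ κ₂ : Fin (d + 1)) :
    ∑ r ∈ box (d + 1) N, ∑' x, ∑' z, S κ' (toSite r) x z (Sum.inl κ₁) (Sum.inl κ₂)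
      = (reflSign α κ' * reflSign α κ₁ * reflSign α κ₂) *
          ∑ r ∈ box (d + 1) N, ∑' x, ∑' z, (S κ' (toSite r) x z (Sum.inl κ₁) (Sum.inl κ₂) + J κ' (toSite r) x z (Sum.inl κ₁) (Sum.inl κ₂)) := by
  set c : Fin (d + 1) → ℤ := -((N : ℤ) • unitVec α) - (if κ' = α then unitVec α else 0) with hc
  have hper : IsPeriodic N (fun u => ∑' x, ∑' z, S κ' u x z (Sum.inl κ₁) (Sum.inl κ₂)) := by
    intro u t
    show (∑' x, ∑' z, S κ' (u + (N : ℤ) • t) x z (Sum.inl κ₁) (Sum.inl κ₂)) = ∑' x, ∑' z, S κ' u x z (Sum.inl κ₁) (Sum.inl κ₂)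
    have step : ∀ G : (Fin (d + 1) → ℤ) → ℝ, ∑' v, G v = ∑' v, G (v + (N : ℤ) • t) := fun G =>
      ((Equiv.addRight ((N : ℤ) • t)).tsum_eq G).symm
    rw [step fun x => ∑' z, S κ' (u + (N : ℤ) • t) x z (Sum.inl κ₁) (Sum.inl κ₂)]
    refine tsum_congr fun x => ?_
    rw [step fun z => S κ' (u + (N : ℤ) • t) (x + (N : ℤ) • t) z (Sum.inl κ₁) (Sum.inl κ₂)]
    refine tsum_congr fun z => ?_
    rw [hS]
    simp only [shiftK, add_neg_cancel_right]
  calc ∑ r ∈ box (d + 1) N, ∑' x, ∑' z, S κ' (toSite r) x z (Sum.inl κ₁) (Sum.inl κ₂)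
      = ∑ r ∈ box (d + 1) N, ∑' x, ∑' z, S κ' (toSite r + c) x z (Sum.inl κ₁) (Sum.inl κ₂) := (sum_box_shift hper c).symm
    _ = ∑ r ∈ box (d + 1) N, ∑' x, ∑' z, S κ' (toSite (bflip α N r) + c) x z (Sum.inl κ₁) (Sum.inl κ₂) :=
        (sum_box_bflip α N (fun r => ∑' x, ∑' z, S κ' (toSite r + c) x z (Sum.inl κ₁) (Sum.inl κ₂))).symm
    _ = ∑ r ∈ box (d + 1) N, ∑' x, ∑' z, S κ' (bref α κ' (toSite r)) x z (Sum.inl κ₁) (Sum.inl κ₂) :=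
        Finset.sum_congr rfl fun r hr => by rw [bref_toSite_eq α κ' hr]
    _ = ∑ r ∈ box (d + 1) N, (reflSign α κ' * reflSign α κ₁ * reflSign α κ₂) *
          ∑' x, ∑' z, (S κ' (toSite r) x z (Sum.inl κ₁) (Sum.inl κ₂) + J κ' (toSite r) x z (Sum.inl κ₁) (Sum.inl κ₂)) :=
        Finset.sum_congr rfl fun r _ => inner_refl_add₃ α hR κ' κ₁ κ₂ (toSite r)
    _ = (reflSign α κ' * reflSign α κ₁ * reflSign α κ₂) *
          ∑ r ∈ box (d + 1) N, ∑' x, ∑' z, (S κ' (toSite r) x z (Sum.inl κ₁) (Sum.inl κ₂) + J κ' (toSite r) x z (Sum.inl κ₁) (Sum.inl κ₂)) := by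
        rw [Finset.mul_sum]

/-- [folklore] **A THREE-INDEX PATTERN ALWAYS HAS AN ODD AXIS**: for every `(κ′, κ₁, κ₂)` there is an axis `α` whose three reflection signs multiply to `−1`. -/
theorem exists_reflSign_prod₃_eq_neg_one (κ' κ₁ κ₂ : Fin (d + 1)) :
    ∃ α : Fin (d + 1), reflSign α κ' * reflSign α κ₁ * reflSign α κ₂ = -1 := by
  by_cases h1 : κ' = κ₁
  · refine ⟨κ₂, ?_⟩
    subst h1
    simp only [PolarizationSign.reflSign]
    by_cases h2 : κ' = κ₂ <;> simp [h2]
  · by_cases h3 : κ₂ = κ'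
    · refine ⟨κ₁, ?_⟩
      subst h3
      simp only [PolarizationSign.reflSign]
      simp [h1]
    · refine ⟨κ', ?_⟩
      simp only [PolarizationSign.reflSign]
      have h1' : ¬κ₁ = κ' := fun h => h1 h.symm
      simp [h1', h3]

/-- NOT IN PRINT; OUR BOOKKEEPING.  **A VERTEX FAMILY THAT IS PLAINLY REFLECTION-COVARIANT IN EVERY AXIS HAS ZERO CELL CHARGE ON ITS WHOLE ff BLOCK**
(`J = 0` in every axis; the odd axis of `exists_reflSign_prod₃_eq_neg_one`). -/
theorem cubicCharge_eq_zero_of_refl {N : ℕ} [NeZero N] {S : Fin (d + 1) → (Fin (d + 1) → ℤ) → MKer (d + 1) (Fib d)}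
    (hS : ∀ (κ' : Fin (d + 1)) (u' t : Fin (d + 1) → ℤ), S κ' (u' + (N : ℤ) • t) = shiftK (-((N : ℤ) • t)) (S κ' u'))
    (hR : ∀ (α κ' : Fin (d + 1)) (u : Fin (d + 1) → ℤ), S κ' (bref α κ' u) = reflSign α κ' • refK (Φ N α) (S κ' u))
    (κ' κ₁ κ₂ : Fin (d + 1)) :
    ∑ r ∈ box (d + 1) N, ∑' x, ∑' z, S κ' (toSite r) x z (Sum.inl κ₁) (Sum.inl κ₂) = 0 := by
  obtain ⟨α, hα⟩ := exists_reflSign_prod₃_eq_neg_one κ' κ₁ κ₂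
  have h := cubicCharge_refl_add (J := fun _ _ => 0) α hS (fun κ' u => by rw [hR]; simp only [add_zero]) κ' κ₁ κ₂
  rw [hα] at h
  simp only [Pi.zero_apply, add_zero] at h
  linarith

/-- NOT IN PRINT; OUR BOOKKEEPING.  **WITH A DEFECT**: along an odd axis `α` of the pattern, twice the cubic cell charge of `S` is minus the charge the defect `J` adds
(so the three-index charges of the comb tower's cubic tables are minus half the charges of their (Sr-conj) contacts — R-2 (2)(b)). -/
theorem two_mul_cubicCharge_eq_neg_of_reflSign_prod {N : ℕ} [NeZero N] {S J : Fin (d + 1) → (Fin (d + 1) → ℤ) → MKer (d + 1) (Fib d)} (α : Fin (d + 1))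
    (hS : ∀ (κ' : Fin (d + 1)) (u' t : Fin (d + 1) → ℤ), S κ' (u' + (N : ℤ) • t) = shiftK (-((N : ℤ) • t)) (S κ' u'))
    (hR : ∀ (κ' : Fin (d + 1)) (u : Fin (d + 1) → ℤ), S κ' (bref α κ' u) = reflSign α κ' • refK (Φ N α) (S κ' u + J κ' u))
    {κ' κ₁ κ₂ : Fin (d + 1)} (hodd : reflSign α κ' * reflSign α κ₁ * reflSign α κ₂ = -1) :
    2 * ∑ r ∈ box (d + 1) N, ∑' x, ∑' z, S κ' (toSite r) x z (Sum.inl κ₁) (Sum.inl κ₂)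
      = -(∑ r ∈ box (d + 1) N, ∑' x, ∑' z, (S κ' (toSite r) x z (Sum.inl κ₁) (Sum.inl κ₂) + J κ' (toSite r) x z (Sum.inl κ₁) (Sum.inl κ₂))
          - ∑ r ∈ box (d + 1) N, ∑' x, ∑' z, S κ' (toSite r) x z (Sum.inl κ₁) (Sum.inl κ₂)) := by
  have h := cubicCharge_refl_add α hS hR κ' κ₁ κ₂
  rw [hodd] at h
  linarith


/-! ## §5 The delta-leg contact adds no ff charge (given the sandwich kernel's Ward zeros) -/

/-- NOT IN PRINT; OUR BOOKKEEPING.  **THE DELTA-LEG CONTACT ADDS NO ff CHARGE**: for a generator whose FIELD leg is the delta `g x (inl β) = [x = u₀ ∧ β = β₀]·c₀`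
and a sandwich kernel `𝕄` with summable rows and columns whose ff constant modes vanish on both sides, the double lattice sum of `S + conjV 𝕄 (diagK g)` on the ff block
equals that of `S` (`conjV_diagK_apply`: the contact is `𝕄 x z · (g z − g x)` entrywise; each half is a row∕column constant mode of `𝕄` at the pinned site). -/
theorem tsum_tsum_add_conjV_diagK_eq {𝕄 S : MKer (d + 1) (Fib d)} {g : (Fin (d + 1) → ℤ) → Fib d → ℝ} {u₀ : Fin (d + 1) → ℤ} {β₀ : Fin (d + 1)} {c₀ : ℝ}
    (hg : ∀ (x : Fin (d + 1) → ℤ) (β : Fin (d + 1)), g x (Sum.inl β) = if x = u₀ ∧ β = β₀ then c₀ else 0)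
    (hMrow : ∀ (x : Fin (d + 1) → ℤ) (a b : Fin (d + 1)), Summable fun z => 𝕄 x z (Sum.inl a) (Sum.inl b))
    (hMcol : ∀ (z : Fin (d + 1) → ℤ) (a b : Fin (d + 1)), Summable fun x => 𝕄 x z (Sum.inl a) (Sum.inl b))
    (hrow0 : ∀ (x : Fin (d + 1) → ℤ) (a b : Fin (d + 1)), ∑' z, 𝕄 x z (Sum.inl a) (Sum.inl b) = 0)
    (hcol0 : ∀ (z : Fin (d + 1) → ℤ) (a b : Fin (d + 1)), ∑' x, 𝕄 x z (Sum.inl a) (Sum.inl b) = 0)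
    (hS₁ : ∀ (x : Fin (d + 1) → ℤ) (a b : Fin (d + 1)), Summable fun z => S x z (Sum.inl a) (Sum.inl b))
    (hS₂ : ∀ (a b : Fin (d + 1)), Summable fun x => ∑' z, S x z (Sum.inl a) (Sum.inl b)) (κ₁ κ₂ : Fin (d + 1)) :
    (∑' x, ∑' z, (S x z (Sum.inl κ₁) (Sum.inl κ₂) + conjV 𝕄 (diagK g) x z (Sum.inl κ₁) (Sum.inl κ₂)))
      = ∑' x, ∑' z, S x z (Sum.inl κ₁) (Sum.inl κ₂) := by
  classical
  -- the contact entrywise: 𝕄 x z · (g z − g x), each `g` a delta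
  have hJ : ∀ x z, conjV 𝕄 (diagK g) x z (Sum.inl κ₁) (Sum.inl κ₂)
      = (if z = u₀ then 𝕄 x z (Sum.inl κ₁) (Sum.inl κ₂) * (if κ₂ = β₀ then c₀ else 0) else 0)
        - (if x = u₀ then 𝕄 x z (Sum.inl κ₁) (Sum.inl κ₂) * (if κ₁ = β₀ then c₀ else 0) else 0) := by
    intro x z
    rw [conjV_diagK_apply, hg, hg, mul_sub]
    by_cases hz : z = u₀ <;> by_cases hx : x = u₀ <;> by_cases h2 : κ₂ = β₀ <;> by_cases h1 : κ₁ = β₀ <;> simp [hz, hx, h1, h2]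
  -- inner sums of the two contact halves
  have hA : ∀ x, Summable fun z => (if z = u₀ then 𝕄 x z (Sum.inl κ₁) (Sum.inl κ₂) * (if κ₂ = β₀ then c₀ else 0) else 0) := fun x =>
    summable_of_ne_finset_zero (s := {u₀}) fun z hz => by rw [Finset.mem_singleton] at hz; rw [if_neg hz]
  have hB : ∀ x, Summable fun z => (if x = u₀ then 𝕄 x z (Sum.inl κ₁) (Sum.inl κ₂) * (if κ₁ = β₀ then c₀ else 0) else 0) := by
    intro x
    by_cases hx : x = u₀
    · simp only [hx, if_true]; exact (hMrow u₀ κ₁ κ₂).mul_right _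
    · simp only [hx, if_false]; exact summable_zero
  have hAsum : ∀ x, ∑' z, (if z = u₀ then 𝕄 x z (Sum.inl κ₁) (Sum.inl κ₂) * (if κ₂ = β₀ then c₀ else 0) else 0)
      = 𝕄 x u₀ (Sum.inl κ₁) (Sum.inl κ₂) * (if κ₂ = β₀ then c₀ else 0) := fun x =>
    tsum_point' u₀ fun z => 𝕄 x z (Sum.inl κ₁) (Sum.inl κ₂) * (if κ₂ = β₀ then c₀ else 0)
  have hBsum : ∀ x, ∑' z, (if x = u₀ then 𝕄 x z (Sum.inl κ₁) (Sum.inl κ₂) * (if κ₁ = β₀ then c₀ else 0) else 0)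
      = if x = u₀ then (∑' z, 𝕄 x z (Sum.inl κ₁) (Sum.inl κ₂)) * (if κ₁ = β₀ then c₀ else 0) else 0 := by
    intro x
    by_cases hx : x = u₀
    · simp only [hx, if_true]; exact tsum_mul_right
    · simp only [hx, if_false, tsum_zero]
  have hJsum : ∀ x, Summable fun z => conjV 𝕄 (diagK g) x z (Sum.inl κ₁) (Sum.inl κ₂) := fun x => by
    simp_rw [hJ]; exact (hA x).sub (hB x)
  have hJin : ∀ x, ∑' z, conjV 𝕄 (diagK g) x z (Sum.inl κ₁) (Sum.inl κ₂) = 𝕄 x u₀ (Sum.inl κ₁) (Sum.inl κ₂) * (if κ₂ = β₀ then c₀ else 0) := by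
    intro x
    simp_rw [hJ]
    rw [(hA x).tsum_sub (hB x), hAsum, hBsum, hrow0]
    simp
  -- split the double sum
  have hin : ∀ x, ∑' z, (S x z (Sum.inl κ₁) (Sum.inl κ₂) + conjV 𝕄 (diagK g) x z (Sum.inl κ₁) (Sum.inl κ₂))
      = (∑' z, S x z (Sum.inl κ₁) (Sum.inl κ₂)) + 𝕄 x u₀ (Sum.inl κ₁) (Sum.inl κ₂) * (if κ₂ = β₀ then c₀ else 0) := fun x => by
    rw [(hS₁ x κ₁ κ₂).tsum_add (hJsum x), hJin]
  simp_rw [hin]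
  rw [(hS₂ κ₁ κ₂).tsum_add ((hMcol u₀ κ₁ κ₂).mul_right _), tsum_mul_right, hcol0, zero_mul, add_zero]

/-- NOT IN PRINT; OUR BOOKKEEPING.  **A COVARIANT VERTEX FAMILY OBEYING THE (Sr-conj)-SHAPED LAW IN EVERY AXIS WITH DELTA-LEG CONTACTS AGAINST A WARD-ZERO SANDWICH KERNEL
HAS ZERO ff CELL CHARGE** (§4 ⨾ §5): the cubic three-index charges of R-2 (2)(b) vanish outright.  The contact at bond `(κ′, u)` in axis `α` is `conjV (𝕄 α) (diagK (g α κ′ u))`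
with field leg `[x = u ∧ β = κ′]·c α κ′` (an2's `ctGen`: `c α κ′ = −γ·[κ′ = α]`). -/
theorem cubicCharge_eq_zero_of_refl_conjV {N : ℕ} [NeZero N] {S : Fin (d + 1) → (Fin (d + 1) → ℤ) → MKer (d + 1) (Fib d)}
    {𝕄 : Fin (d + 1) → MKer (d + 1) (Fib d)} {g : Fin (d + 1) → Fin (d + 1) → (Fin (d + 1) → ℤ) → (Fin (d + 1) → ℤ) → Fib d → ℝ} {c : Fin (d + 1) → Fin (d + 1) → ℝ}
    (hS : ∀ (κ' : Fin (d + 1)) (u' t : Fin (d + 1) → ℤ), S κ' (u' + (N : ℤ) • t) = shiftK (-((N : ℤ) • t)) (S κ' u'))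
    (hR : ∀ (α κ' : Fin (d + 1)) (u : Fin (d + 1) → ℤ), S κ' (bref α κ' u) = reflSign α κ' • refK (Φ N α) (S κ' u + conjV (𝕄 α) (diagK (g α κ' u))))
    (hg : ∀ (α κ' : Fin (d + 1)) (u x : Fin (d + 1) → ℤ) (β : Fin (d + 1)), g α κ' u x (Sum.inl β) = if x = u ∧ β = κ' then c α κ' else 0)
    (hMrow : ∀ (α : Fin (d + 1)) (x : Fin (d + 1) → ℤ) (a b : Fin (d + 1)), Summable fun z => 𝕄 α x z (Sum.inl a) (Sum.inl b))
    (hMcol : ∀ (α : Fin (d + 1)) (z : Fin (d + 1) → ℤ) (a b : Fin (d + 1)), Summable fun x => 𝕄 α x z (Sum.inl a) (Sum.inl b))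
    (hrow0 : ∀ (α : Fin (d + 1)) (x : Fin (d + 1) → ℤ) (a b : Fin (d + 1)), ∑' z, 𝕄 α x z (Sum.inl a) (Sum.inl b) = 0)
    (hcol0 : ∀ (α : Fin (d + 1)) (z : Fin (d + 1) → ℤ) (a b : Fin (d + 1)), ∑' x, 𝕄 α x z (Sum.inl a) (Sum.inl b) = 0)
    (hS₁ : ∀ (κ' : Fin (d + 1)) (u x : Fin (d + 1) → ℤ) (a b : Fin (d + 1)), Summable fun z => S κ' u x z (Sum.inl a) (Sum.inl b))
    (hS₂ : ∀ (κ' : Fin (d + 1)) (u : Fin (d + 1) → ℤ) (a b : Fin (d + 1)), Summable fun x => ∑' z, S κ' u x z (Sum.inl a) (Sum.inl b))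
    (κ' κ₁ κ₂ : Fin (d + 1)) :
    ∑ r ∈ box (d + 1) N, ∑' x, ∑' z, S κ' (toSite r) x z (Sum.inl κ₁) (Sum.inl κ₂) = 0 := by
  obtain ⟨α, hα⟩ := exists_reflSign_prod₃_eq_neg_one κ' κ₁ κ₂
  have h := two_mul_cubicCharge_eq_neg_of_reflSign_prod (J := fun κ' u => conjV (𝕄 α) (diagK (g α κ' u))) α hS (hR α) hα
  have hz : ∀ r ∈ box (d + 1) N, ∑' x, ∑' z, (S κ' (toSite r) x z (Sum.inl κ₁) (Sum.inl κ₂) + conjV (𝕄 α) (diagK (g α κ' (toSite r))) x z (Sum.inl κ₁) (Sum.inl κ₂))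
      = ∑' x, ∑' z, S κ' (toSite r) x z (Sum.inl κ₁) (Sum.inl κ₂) := fun r _ =>
    tsum_tsum_add_conjV_diagK_eq (hg α κ' (toSite r)) (hMrow α) (hMcol α) (hrow0 α) (hcol0 α) (hS₁ κ' (toSite r)) (hS₂ κ' (toSite r)) κ₁ κ₂
  rw [Finset.sum_congr rfl hz] at h
  linarith

end Summit.QuantumFields.BalabanUV.Beta.GAN24.ZeroModeReflectionParity

end
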